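import Literature.Probability.RandomPlanarGeometry.HexSAWPolygonCellsHostTransfer
import Literature.Probability.RandomPlanarGeometry.HexSAWPolygonCellsPolygonMoves
import Literature.Probability.RandomPlanarGeometry.SAWPolygonTraversal
import HarnessLib

/-!
# Cell calculus for honeycomb polygon surgery, XXIV: peeling keeps the boundary a POLYGON; no hexagon of a polygon-bounded set is isolated

Topic `Literature/Probability/RandomPlanarGeometry` (lane «pcv-sawmu», a-p4 g22; sequel of VI `…CellsPeel`, VII `…CellsHostTransfer` (`IsSpikeTop`), XIX
`…CellsPolygonMoves` (`isPolygon_bdry_erase`), XVIII `…CellsCorners`; uses the tree's `SAWPolygonTraversal` (`IsPolygon.exists_isPolyTraversal`,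
`IsPolyTraversal.follows_path`)).

Two inputs of the classification of bases (DESIGN-BRIDGE-g22 §2, LEMMA CLASS): ★ `isPolygon_bdry_peel` — if `bdry S` is a honeycomb polygon then so is
`bdry (peel S)` (each peeled spike top has the single contact `LL m` and `perim ≥ 7`: `seven_le_perim_of_isSpikeTop`); ★ `nbrs_inter_nonempty_of_isPolygon`
(LEMMA ISO) — in a brick set with polygonal boundary and at least two hexagons, every hexagon has a contact: otherwise its six bonds lie on the polygon, a
traversal of the polygon follows them round the hexagon (`follows_path` + trivalence `cells_at_corner`) and closes up after six bonds, whereas the other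
hexagons contribute a seventh boundary bond.

Sources: N. Madras, G. Slade, *The Self-Avoiding Walk* (1993), §3.2, Definition 3.2.1 p. 62 (degree two) and the proof of Theorem 3.2.3 [MadrasSlade1993];
I. Jensen, J. Phys.: Conf. Ser. 42 (2006) 163 [Jensen2006HoneycombPolygons].  Label (lane): LANE INFRASTRUCTURE; nothing new in writing.
-/

open Finset Literature.Probability.LatticeModels

namespace Literature.Probability.RandomPlanarGeometry.SAW

namespace HexCell

/-! ### Perimeter lower bounds -/

/-- The perimeter dominates the free bonds of any two hexagons. [cite: Jensen2006HoneycombPolygons, §2] -/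
theorem card_add_card_le_perim {S : Finset Cell} {c d : Cell} (hc : c ∈ S) (hd : d ∈ S) (hne : c ≠ d) :
    #(nbrs c \ S) + #(nbrs d \ S) ≤ perim S := by
  have e : ∑ x ∈ ({c, d} : Finset Cell), #(nbrs x \ S) = #(nbrs c \ S) + #(nbrs d \ S) := sum_pair hne
  rw [perim, ← e]
  refine sum_le_sum_of_subset fun x hx => ?_
  rcases mem_insert.1 hx with rfl | hx
  · exact hc
  · rw [mem_singleton.1 hx]; exact hd

/-- A set with a spike top has perimeter `≥ 7` (five free bonds at the spike, two at its support). [cite: MadrasSlade1993, §3.2 (proof of Theorem 3.2.3)] -/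
theorem seven_le_perim_of_isSpikeTop {S : Finset Cell} {m : Cell} (h : IsSpikeTop S m) : 7 ≤ perim S := by
  have hm : m ∈ S := h.1.1
  have hll : LL m ∈ S := h.ll_mem
  have hne : m ≠ LL m := by intro e; have := congrArg Prod.snd e; simp at this; omega
  have h5 : #(nbrs m \ S) = 5 := by
    have := card_sdiff_add_card_inter (nbrs m) S
    rw [h.2, card_singleton, card_nbrs] at this; omega
  have h2 : 2 ≤ #(nbrs (LL m) \ S) := by
    have hLm : L m ∉ S := fun hx => by
      have := h.eq_ll_of_mem (by rw [mem_nbrs_iff]; simp [L]) hx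
      have := congrArg Prod.snd this; simp at this; omega
    have hLRm : LR m ∉ S := fun hx => by
      have := h.eq_ll_of_mem (by rw [mem_nbrs_iff]; simp [LR]) hx
      have := congrArg Prod.fst this; simp at this; omega
    have hsub : ({L m, LR m} : Finset Cell) ⊆ nbrs (LL m) \ S := by
      intro x hx
      rw [mem_sdiff, mem_nbrs_iff]
      rcases mem_insert.1 hx with rfl | hx
      · exact ⟨by right; right; right; right; left; exact Prod.ext (show m.1 - 2 = m.1 - 1 - 1 by omega) (show m.2 = m.2 - 1 + 1 by omega), hLm⟩
      · rw [mem_singleton.1 hx]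
        exact ⟨by right; right; left; exact Prod.ext (show m.1 + 1 = m.1 - 1 + 2 by omega) (show m.2 - 1 = m.2 - 1 from rfl), hLRm⟩
    have hpair : #({L m, LR m} : Finset Cell) = 2 :=
      card_pair (by intro e; have := congrArg Prod.fst e; simp at this; omega)
    exact hpair ▸ card_le_card hsub
  have := card_add_card_le_perim hm hll hne
  omega

/-! ### Peeling keeps the boundary a polygon -/

/-- The spike top has the contact arc `{LL}` of length one. [cite: MadrasSlade1993, §3.2 (proof of Theorem 3.2.3)] -/
theorem arc_of_isSpikeTop {S : Finset Cell} {m : Cell} (h : IsSpikeTop S m) : ∀ i < 6, nbrDir m (0 + i) ∈ S ↔ i < 1 := by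
  intro i hi
  rw [Nat.zero_add]
  constructor
  · intro hin
    have e := h.eq_ll_of_mem (nbrDir_mem_nbrs m i) hin
    have : nbrDir m i = nbrDir m 0 := by rw [e]; rfl
    have := nbrDir_injective_mod this
    omega
  · intro hi0
    have : i = 0 := by omega
    subst this
    exact h.ll_mem

/-- Peeling a spike top keeps the boundary a polygon. [cite: MadrasSlade1993, §3.2, proof of Theorem 3.2.3 pp. 64–65] -/
theorem isPolygon_bdry_erase_of_isSpikeTop {S : Finset Cell} {m : Cell} (hS : IsBrickSet S) (h : IsSpikeTop S m)
    (hP : IsPolygon brickWallGraph (bdry S)) : IsPolygon brickWallGraph (bdry (S.erase m)) :=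
  isPolygon_bdry_erase hS h.1.1 hP (seven_le_perim_of_isSpikeTop h) (arc_of_isSpikeTop h)

open Classical in
/-- ★ **`bdry (peel S)` is a polygon when `bdry S` is.** [cite: MadrasSlade1993, §3.2, proof of Theorem 3.2.3 pp. 64–65] -/
theorem isPolygon_bdry_peel {S : Finset Cell} (hS : IsBrickSet S) (hP : IsPolygon brickWallGraph (bdry S)) :
    IsPolygon brickWallGraph (bdry (peel S)) := by
  induction S using Finset.strongInduction with
  | H S ih =>
    by_cases hp : ∃ m, Peelable S m
    · obtain ⟨m, hm⟩ := hp
      rw [peel_eq_peel_erase hm]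
      exact ih _ (erase_ssubset hm.mem) (fun c hc => hS c (mem_of_mem_erase hc)) (isPolygon_bdry_erase_of_isSpikeTop hS hm.1 hP)
    · rw [peel_eq_self hp]; exact hP

/-- Peeling keeps bricks bricks. [cite: EntingJensen2009, §7.4.2] -/
theorem isBrickSet_peel {S : Finset Cell} (hS : IsBrickSet S) : IsBrickSet (peel S) := fun c hc => hS c (peel_subset S hc)

/-! ### No hexagon of a polygon-bounded set is isolated -/

/-- The vertices of `arcWalk`. [cite: MadrasSlade1993, §3.2 (proof of Theorem 3.2.3)] -/
theorem getVert_arcWalk {c : Cell} (hc : Even (c.1 + c.2)) (a : ℕ) {m k : ℕ} (hk : k ≤ m) :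
    (arcWalk hc a m).getVert k = corner c (a + k) := by
  induction m generalizing k with
  | zero =>
    have hk0 : k = 0 := by omega
    subst hk0; rfl
  | succ m ih =>
    rw [arcWalk, SimpleGraph.Walk.concat_eq_append, SimpleGraph.Walk.getVert_append, length_arcWalk]
    split_ifs with h
    · exact ih (by omega)
    · rcases eq_or_lt_of_le (Nat.not_lt.1 h) with rfl | hlt
      · simp
      · have hk1 : k = m + 1 := by omega
        subst hk1
        rw [Nat.add_sub_cancel_left, SimpleGraph.Walk.getVert_cons_succ, SimpleGraph.Walk.getVert_zero]

/-- ★ **LEMMA ISO**: in a brick set with polygonal boundary containing another hexagon, every hexagon has a contact.  (If `c` were isolated its six bonds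
would lie on the polygon; a traversal follows them round `c` — degree two and trivalence — and closes after six bonds, but the other hexagons contribute a
seventh.) [cite: MadrasSlade1993, §3.2, Definition 3.2.1 p. 62 (a polygon is ONE closed self-avoiding walk)] -/
theorem nbrs_inter_nonempty_of_isPolygon {S : Finset Cell} (hS : IsBrickSet S) (hP : IsPolygon brickWallGraph (bdry S)) {c : Cell} (hc : c ∈ S)
    (h2 : ∃ c' ∈ S, c' ≠ c) : (nbrs c ∩ S).Nonempty := by
  classical
  by_contra hiso
  rw [not_nonempty_iff_eq_empty] at hiso
  have hcb := hS c hc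
  have hfree : ∀ i, nbrDir c i ∉ S := fun i hin => by
    have : nbrDir c i ∈ nbrs c ∩ S := mem_inter.2 ⟨nbrDir_mem_nbrs c i, hin⟩
    rw [hiso] at this; exact notMem_empty _ this
  have hbond : ∀ i, bond c (nbrDir c i) ∈ bdry S := fun i => bond_mem_bdry hc (nbrDir_mem_nbrs c i) (hfree i)
  -- perimeter ≥ 7: six free bonds at `c`, one more at the top hexagon of `S ∖ c`
  have h7 : 7 ≤ perim S := by
    obtain ⟨c', hc', hne⟩ := h2
    obtain ⟨t, ht⟩ := exists_isLexmax (⟨c', mem_erase.2 ⟨hne, hc'⟩⟩ : (S.erase c).Nonempty)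
    have htS : t ∈ S := mem_of_mem_erase ht.1
    have htc : t ≠ c := (mem_erase.1 ht.1).1
    have h6 : #(nbrs c \ S) = 6 := by
      rw [← card_nbrs c, sdiff_eq_self_of_disjoint (disjoint_iff_inter_eq_empty.2 hiso)]
    have h1 : 1 ≤ #(nbrs t \ S) := by
      refine card_pos.2 ⟨UR t, mem_sdiff.2 ⟨by rw [mem_nbrs_iff]; simp [UR], fun hu => ?_⟩⟩
      by_cases e : UR t = c
      · apply hfree 0
        rw [show nbrDir c 0 = LL c from rfl, ← e, show LL (UR t) = t by ext <;> simp]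
        exact htS
      · exact ht.ur_notMem (mem_erase.2 ⟨e, hu⟩)
    have := card_add_card_le_perim hc htS (Ne.symm htc)
    omega
  have hL : 7 ≤ #(bdry S) := by rw [card_bdry hS]; exact h7
  -- a traversal through the bond in direction 0 follows the arc `corner 0 → ⋯ → corner 5`
  obtain ⟨u, hu, hu0, hu1⟩ := hP.exists_isPolyTraversal (a := corner c 0) (b := corner c 1) (by rw [← bond_nbrDir]; exact hbond 0)
  have hfollow := hu.follows_path hP (arcWalk hcb 0 5) (isPath_arcWalk hcb 0 le_rfl)
    (fun e he => by obtain ⟨j, -, rfl⟩ := (mem_edges_arcWalk hcb).1 he; exact hbond _) (i := 0) hu0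
    (fun _ => by rw [Nat.zero_add, getVert_arcWalk hcb 0 (by norm_num), Nat.zero_add]; exact hu1)
  have hk : ∀ k ≤ 5, u k = corner c k := fun k hk => by
    have := hfollow k (by rw [length_arcWalk]; exact hk)
    rw [Nat.zero_add, getVert_arcWalk hcb 0 hk, Nat.zero_add] at this
    exact this
  -- the bond `u 5 – u 6` of the polygon sits at `corner c 5`, hence is a bond of `c` (trivalence: the two other hexagons there are not in `S`)
  have h56 := hu.mem 5
  rw [hk 5 le_rfl] at h56
  obtain ⟨w, hw, v, hv, -, hwv⟩ := mem_bdry_iff.1 h56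
  have hcor : corner c 5 ∈ bond w v := by rw [hwv]; exact Sym2.mem_mk_left _ _
  have hwc : w = c := by
    rcases cells_at_corner hcb (hS w hw) hv hcor with e | e | e
    · exact e
    · exact absurd hw (e ▸ hfree _)
    · exact absurd hw (e ▸ hfree _)
  subst hwc
  obtain ⟨i, hi6, rfl⟩ := (mem_nbrs_iff_exists_nbrDir 0).1 hv
  rw [Nat.zero_add, bond_nbrDir] at hwv
  have hu6 : u 6 = corner w i ∨ u 6 = corner w (i + 1) :=
    Sym2.mem_iff.1 (by rw [hwv]; exact Sym2.mem_mk_right _ _)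
  have h5 : corner w 5 = corner w i ∨ corner w 5 = corner w (i + 1) :=
    Sym2.mem_iff.1 (by rw [hwv]; exact Sym2.mem_mk_left _ _)
  have hne64 : u 6 ≠ corner w 4 := by rw [← hk 4 (by norm_num)]; exact hu.ne_succ_succ 4
  have hne65 : u 6 ≠ corner w 5 := by rw [← hk 5 le_rfl]; exact (hu.adj 5).ne.symm
  have hi : i = 4 ∨ i = 5 := by
    rcases h5 with h5 | h5
    · have := corner_injective_mod h5; omega
    · have := corner_injective_mod h5; omega
  rcases hi with rfl | rfl
  · rcases hu6 with h6 | h6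
    · exact hne64 h6
    · exact hne65 h6
  · rcases hu6 with h6 | h6
    · exact hne65 h6
    · have hu60 : u 6 = u 0 := by rw [h6, hu0]; exact corner_eq_of_mod_eq w (by norm_num)
      have := hu.inj 6 0 (by omega) (by omega) hu60
      omega

end HexCell

end Literature.Probability.RandomPlanarGeometry.SAW
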